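import Summits.QuantumFields.YangMills.Theorems.BalabanUVNodesKLCPrAtHierFrameInClass
import Summits.QuantumFields.YangMills.Theorems.BalabanUVNodesN07Thm312PrEntryRowsOfParts
import HarnessLib

/-!
# THE GL PIN, IN-CLASS ∕ OF-PARTS EDITION — ✓`…_of_entryRows_inClass` (PT-B g13 13a) with {W2}'s single displayed (3.133) row of `H₁^{pr}(U₀)` REPLACED BY ITS TWO PRINTED
# SOURCES ([B9] p.423 «from (3.129) and (3.132) with G₁ instead of G we get the inequalities (3.133) for H₁»; dag-n06-l ✓`N07Thm312PrEntryRowsOfParts.h1pr_entryRows_of_parts`)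

Cell `pub-ymgap` ∕ `ym-nodeO-ideate`, porter lineage `ymgap-nodeO-port-PTB-1` (gen 13), second arrival of record = dag-n06-l g43 INTENT-4 «(S-H) file 1»
`Theorems/BalabanUVNodesN07Thm312PrEntryRowsOfParts.lean` (addressed «dag-n07-e lineage ∕ ★ PT-B (consumers of the `B9.Thm312Printed … h1KernelRecPrN00 …` display)», pub-ymgap INBOX
2026-08-31T21:43Z).  `--kind proof --supports stmt-QuantumFields-27238 --as helper`; count-neutral; NEW basename; ✓`…KLCPrAtHierFrameInClass`, ✓`…N07Thm312PrEntryRowsOfParts` NOT edited.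
[B7] = [Balaban1985Averaging]; [B9] = [Balaban1985BackgroundPropagators]; [B10] = [Balaban1984PropagatorsII]; [B11] = [Balaban1985Variational].

WHAT IS PROVED (0 def, 0 sorry, axioms standard; ns `Summit.QuantumFields.YangMills.Theorems.KExpOfRecordPr`; node-00, `0 < k ≤ m + K`):
* §1 ★★★ `prop4UniformPrAtRecord_node00_of_prop5Clause_hierFrameGLRec_of_h1prParts_inClass` — the in-class GL pin with {W2} `h0∕h1` (the (3.133) rows of `H₁^{pr}(U₀)` at `(B₀, ρ)`)
  DERIVED from the two PRINTED SOURCE ROWS at the framed record pair `(Q^{pr}(U₀; 𝔥ᴳᴸ), Q′(U₀))`: (G) `hG0∕hG1` — Theorem 3.3-type entry rows of `G₁(U₀)Q^{pr,*}` read in (115)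
  (dag-n06-l's reading `g1QadjPrRead`), rate `ρ`, constant `B₁`; (K) `hKi` — the (3.132) kernel rows of `(Q^{pr}G₁Q^{pr,*})⁻¹` (reading `kinvPrRead`, kernel `kerBlk`), rate `ρ`, constant `B₂`;
  inside, `B₀ := B₁B₂·d(2(1+2∕ρ))^d` and the (3.133) rate is `ρ∕2` (print's `e^{−(1∕2)δ₁d}`, [B10] (2.61)), so every downstream constant of the pin (`b`, `r`, `R′`, `N₁`, `E`) is
  the 13a one AT `(B₀, ρ) := (B₁B₂·d(2(1+2∕ρ))^d, ρ∕2)` — displayed verbatim in that currency.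
* §2 ★★★ `…_of_h1prParts_inClass_ukSel`, §3 ★★★ `…_of_h1prParts_inClass_rootGaugeC_ukSel` — the same READ AT THE MINIMISER OF RECORD `UkSel F N K k ε V` ∕ at DEF-1's centred
  rooted gauge `rootGaugeC k (UkSel F N K k ε V)` (`recordBgFieldC` shape), class letter in [B11] Thm 1's currency at the datum `V` (`hex`, `huniq`, `hcl`) as in 13a §2∕§3.
REMAINING displayed letters at the record's background: `hpos` ({W1} framed half), (G) `hG0∕hG1` + (K) `hKi` (the two sources of {W2}; XL, lane N07 ∕ [B9] Thm 3.3 for `G₁` at the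
framed pair + (3.130)–(3.132)), {W3} `hS∕hR`, {W4} `h157` + `r + r ≤ α₁`, the k-free window, (14) `hreg`, `∀ x, x ∈ Ω_k`, Thm 1 rows, four `ε₀` ceilings, numerics.

HONEST FRAMING.  Glue BY NAME (n06-l's hence-step (3.129)+(3.132) ⟹ (3.133) at the framed pair; n07-e's corrector road; gauge invariance of (2)); (G), (K), {W1} `hpos`, {W3}, {W4},
(14) `hreg`, the Thm 1 rows are DISPLAYED hypotheses INHABITED NOWHERE; nothing of [B7] Prop. 5 ∕ Sect. E, [B9] Thm 3.3 ∕ 3.11 ∕ 3.12, [B11] Thm 1 ∕ (72)–(73) ∕ Prop. 4 is proved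
here; K0ᴬ ⟨stmt-QuantumFields-27238⟩ NOT closed (0∕2); ⟨27931⟩ CLOSED·IMPLICATION-ONLY; NODE O 0∕1; COUNT 8∕28 · K 1∕4 UNMOVED; one finite `𝕋⁴_{L^K}` programme at fixed ε —
NOT continuum ∕ ℝ⁴ ∕ OS ∕ Clay; **the Yang–Mills mass gap (Clay) is NOT proved by any of this.**  No `sorry`, `instance`, `notation`, `set_option`; standard axioms.
-/

noncomputable section

open scoped Matrix Matrix.Norms.L2Operator InnerProductSpace ComplexConjugate BigOperators
open Classical

namespace Summit.QuantumFields.YangMills.Theorems.KExpOfRecordPr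

open Literature.MathematicalPhysics.QuantumFieldTheory.Balaban1983to89
open Literature.MathematicalPhysics.QuantumFieldTheory.Balaban1983to89.Node00
open Literature.MathematicalPhysics.QuantumFieldTheory.Balaban1983to89.BlockAveragingEMLHaarAC (emlWeight)
open Literature.MathematicalPhysics.QuantumFieldTheory.Balaban1983to89.ExpMeanLog (deltaSU)
open Summit.QuantumFields.YangMills.Theorems.KExpOfRecord (KRecIdx kexpOfRecord)
open T4Continuum BlockAveraging
open B11Eq103H1Complex (SiteL2K)
open B9SectCLatticeCarrier (Bond)
open B11Eq115Space (NegSup NegSize JetSup levWeight levWeight_apply)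
open B11Eq111FrakG (nabla115)
open Summit.QuantumFields.YangMills.BalabanUVNodes.N07Prop4LetterHOfThm312 (blkOfBond)
open Summit.QuantumFields.YangMills.BalabanUVNodes.N07KernelEntriesOfRecord (entry0 entry1 nColOp)
open Summit.QuantumFields.YangMills.BalabanUVNodes.N07KLNOfLocalityRows (blockRow0 blockRow1)
open Summit.QuantumFields.YangMills.BalabanUVNodes.N07AtRecordTwoTier (eps_pos_of_inUkClassB11)
open Summit.QuantumFields.YangMills.BalabanUVNodes.N07Thm312PrEntryRowsOfParts (kerBlk g1QadjPrRead kinvPrRead h1pr_entryRows_of_parts)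
open Summit.QuantumFields.YangMills.Theorems.BlockAvgCorrector (stokesConst)
open Summit.QuantumFields.YangMills.Theorems.N07QCplxOpOntoGuarded (qCplxOp_surjective_of_inUkClassB11 QprOfRecord_surjective_hierFrameGL_of_inUkClassB11)
open Summit.QuantumFields.YangMills.Theorems.RootedGaugeCentred (rootGaugeC orbitRel_rootGaugeC)
open GaugeField (gaugeAct)

variable (F : T4Family) (N : ℕ) [NeZero N]

/-! ## §1  The in-class GL pin with {W2} read from (G) + (K) -/

section OfParts

variable (K k : ℕ) (Ω : ℕ → Set (Site (F.P K) 0)) (U₀ : GaugeField (F.P K) 0 (SU N))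
variable [Fact (0 < (F.L : ℝ))] [Fact (0 < (F.P K).eta k)] [Fact (0 < c0Rec F K k)] [Fact (∀ c, 0 < wBRec F K k c)]

/-- ★★★ **THE GL PIN, IN-CLASS ∕ OF-PARTS EDITION — {W2}'s (3.133) ROW REPLACED BY ITS TWO PRINTED SOURCES**: 13a's ✓`…_of_entryRows_inClass` with `h0∕h1` (entry rows of
`H₁^{pr}(U₀)` at `(B₀, ρ)`) DERIVED by dag-n06-l's ✓`h1pr_entryRows_of_parts` from (G) `hG0∕hG1`: the entry rows of `G₁(U₀)Q^{pr,*}` read in (115) (`g1QadjPrRead … hpos`, [B9] Thm 3.3-type,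
rate `ρ`, constant `B₁`) and (K) `hKi`: the kernel rows of `(Q^{pr}G₁Q^{pr,*})⁻¹` (`kerBlk (kinvPrRead … hpos hQ)`, (3.132)-type, rate `ρ`, constant `B₂`) — with `(B₀, ρ) := (B₁B₂·d(2(1+2∕ρ))^d, ρ∕2)`
in every downstream constant.  REMAINING displayed letters: `hpos`, (G), (K), {W3} `hS∕hR`, {W4} `h157` + `r + r ≤ α₁`, the k-free window `hq`, (14) `hreg`, `∀ x, x ∈ Ω_k`, the class
letter `hcl` + four `ε₀` ceilings, numeric rows.  Glue BY NAME; (G), (K) NOT proved anywhere in the tree (XL); {W1}–{W4} INHABITED NOWHERE.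
[cite: Balaban1985BackgroundPropagators, Thm 3.12 pp.421–423, (3.129) p.421, (3.132)–(3.133) p.422, Thm 3.3 (3.42) p.397, (3.13)–(3.16) p.393, (3.113)–(3.115) p.418; Balaban1984PropagatorsII, Lemma 2.1 (2.61) p.234; Balaban1985Variational, Prop. 4 (97)–(98) pp.292–293, (2) p.278, (14) p.280, (45)–(46) p.285, (72)–(73) p.289, (86)–(89) p.291, (103) p.293; Balaban1985Averaging, Proposition 5 (157) p.42; Balaban1987RG1, (1.2) p.260] -/
theorem prop4UniformPrAtRecord_node00_of_prop5Clause_hierFrameGLRec_of_h1prParts_inClass (levB : PBond (F.P K) k → ℕ) (a : ℝ)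
    (hpos : ∀ x, x ≠ 0 → 0 < RCLike.re ⟪x, laplaceAOfRecord F N k U₀ (QprOfRecord F N k U₀ (hierFrameGLDatumOfRecord F N k U₀)) (QprimeOfRecord F N k U₀) a x⟫_ℂ)
    (Gp : SiteL2K ℂ (F.P K).d (fun _ => (F.P K).sitesPerDir 0) (c0Rec F K k) (WRec N) →ₗ[ℂ]
      SiteL2K ℂ (F.P K).d (fun _ => (F.P K).sitesPerDir 0) (c0Rec F K k) (WRec N))
    {α ε₀ : ℝ} (hkpos : 0 < k) (hkm : k ≤ (F.P K).m + (F.P K).K) (hΩ : ∀ x, x ∈ Ω k) (hαpos : 0 < α) (hα : α * (11000000 * N) ≤ 1)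
    (hreg : ∀ j, j < k → PlaqSmall (α * ((F.L : ℝ) ^ j * (F.P K).eta k) ^ 2) (Averaging.iter (avOfRecord F N K) j U₀))
    -- {W1}'s un-framed onto row `hqon` AND the current letter `‖J(U₀)‖ ≤ nJ` BOTH from [B11] (2)'s class letter `hcl` (dag-n07-e ✓p835435 `qCplxOp_surjective_of_inUkClassB11`;
    -- ✓`norm_JOfRecordAtBg_le_of_inUkClassB11`, `nJ := ε₀`), at the price of MODULE 144's four ceilings on `ε₀` (`0 < ε₀` is forced by the class: ✓`eps_pos_of_inUkClassB11`)
    (h3 : (143 * (((((F.P K).d + 4 : ℕ) : ℝ)) ^ 2 / 4) ^ 2) * ε₀ ≤ 1 / 3)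
    (h2 : 2 * ε₀ ≤ 2 * deltaSU (Fin N) / ((((F.P K).d + 4) * (F.P K).L : ℕ) : ℝ) ^ 2)
    (hst : stokesConst (F.P K) * (2 * ε₀) < emlWeight (F.P K) / 16) (hstδ : stokesConst (F.P K) * (2 * ε₀) < deltaSU (Fin N))
    (hcl : InUkClassB11 F N K k ε₀ U₀)
    -- {W2} READ FROM ITS TWO PRINTED SOURCES (print p.423 «from (3.129) and (3.132) with G₁ instead of G we get (3.133) for H₁»; dag-n06-l ✓`h1pr_entryRows_of_parts`):
    -- (G) Theorem 3.3-type entry rows of `G₁(U₀)Q^{pr,*}` read in (115), (K) the (3.132) kernel rows of `(Q^{pr}G₁Q^{pr,*})⁻¹`, both at rate `ρ` — DISPLAYED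
    {ρ B₁ B₂ : ℝ} (hρ : 0 < ρ) (hB₁ : 0 ≤ B₁) (hB₂ : 0 ≤ B₂)
    (hG0 : ∀ y'' y₁ : PBond (F.P K) k, entry0 F N K k Ω U₀ levB (g1QadjPrRead F N K k Ω U₀ (hierFrameGLDatumOfRecord F N k U₀) levB a hpos) y'' y₁ ≤ B₁ * Real.exp (-(ρ * (Site.tdist y''.src y₁.src : ℝ))))
    (hG1 : ∀ y'' y₁ : PBond (F.P K) k, entry1 F N K k Ω U₀ levB (g1QadjPrRead F N K k Ω U₀ (hierFrameGLDatumOfRecord F N k U₀) levB a hpos) y'' y₁ ≤ B₁ * Real.exp (-(ρ * (Site.tdist y''.src y₁.src : ℝ))))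
    (hKi : ∀ y₁ y : PBond (F.P K) k, ‖kerBlk F N K k levB (kinvPrRead F N K k U₀ (hierFrameGLDatumOfRecord F N k U₀) levB a hpos
      (QprOfRecord_surjective_hierFrameGL_of_inUkClassB11 hkm (eps_pos_of_inUkClassB11 hcl) h3 h2 hst hstδ hcl)) y₁ y‖ ≤ B₂ * Real.exp (-(ρ * (Site.tdist y₁.src y.src : ℝ))))
    -- (KL-C)ᵖʳ := the (157) clause of `B7.Prop5Printed (kexpOfRecordPr F N 𝔥ᴳᴸ)` at `(α, α₁, C₃)`, `r + r ≤ α₁`, and the window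
    {C₃ α₁ : ℝ} (hC₃ : 0 ≤ C₃)
    (h157 : ∀ (i : KRecIdx F) (W₀ : (kexpOfRecordPr F N (fun K k (U : GaugeField (F.P K) 0 (SU N)) => hierFrameGLDatumOfRecord F N k U) i).Cfg), (kexpOfRecordPr F N (fun K k (U : GaugeField (F.P K) 0 (SU N)) => hierFrameGLDatumOfRecord F N k U) i).plaqDevEta W₀ < α →
      ∀ A : (kexpOfRecordPr F N (fun K k (U : GaugeField (F.P K) 0 (SU N)) => hierFrameGLDatumOfRecord F N k U) i).Fld, (kexpOfRecordPr F N (fun K k (U : GaugeField (F.P K) 0 (SU N)) => hierFrameGLDatumOfRecord F N k U) i).fldNorm A < α₁ → (kexpOfRecordPr F N (fun K k (U : GaugeField (F.P K) 0 (SU N)) => hierFrameGLDatumOfRecord F N k U) i).dCk W₀ A ≤ C₃ * (kexpOfRecordPr F N (fun K k (U : GaugeField (F.P K) 0 (SU N)) => hierFrameGLDatumOfRecord F N k U) i).fldNorm A)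
    (hrα₁ : letI b : ℝ := (B₁ * B₂ * ((F.P K).d * (2 * (1 + 1 / (ρ / 2))) ^ (F.P K).d)) * ((F.P K).d * (2 * (1 + 1 / (ρ / 2))) ^ (F.P K).d)
      letI C₂ : ℝ := 281600000000000000 * (F.L : ℝ) * N
      letI c₄ : ℝ := 1 / (200000000000 * (F.L : ℝ) * N)
      letI r : ℝ := min (c₄ / 4) (min (1 / 2) (1 / (16 * (b * C₂ + 1))))
      r + r ≤ α₁)
    -- the window, k-FREE: `(r+r)·Θ_H·G = (r+r)·b·2dC₃ · ((L^d)^k η_k^d) = (r+r)·b·2dC₃` since `L^k η_k = 1`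
    (hq : letI b : ℝ := (B₁ * B₂ * ((F.P K).d * (2 * (1 + 1 / (ρ / 2))) ^ (F.P K).d)) * ((F.P K).d * (2 * (1 + 1 / (ρ / 2))) ^ (F.P K).d)
      letI C₂ : ℝ := 281600000000000000 * (F.L : ℝ) * N
      letI c₄ : ℝ := 1 / (200000000000 * (F.L : ℝ) * N)
      letI r : ℝ := min (c₄ / 4) (min (1 / 2) (1 / (16 * (b * C₂ + 1))))
      (r + r) * b * (2 * ((F.P K).d : ℝ) * C₃) ≤ 1 / 2)
    -- {W3} := the locality rows of the current reader `Δπ(U₀; G′, Q′)` ([B11] (72)–(73)∕(86)–(89)): (L) fine majorants `s₀, s₁`, (R) block-aggregated row decay — DISPLAYED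
    {s0 : Bond (F.P K).d (fun _ => (F.P K).sitesPerDir 0) → Bond (F.P K).d (fun _ => (F.P K).sitesPerDir 0) → ℝ} {s1 : Bond (F.P K).d (fun _ => (F.P K).sitesPerDir 0) → Bond (F.P K).d (fun _ => (F.P K).sitesPerDir 0) × Fin (F.P K).d → ℝ} (hs0 : ∀ b' x, 0 ≤ s0 b' x) (hs1 : ∀ b' p, 0 ≤ s1 b' p)
    (hS : ∀ (A : Space115Lit F N K k Ω U₀) (b' : Bond (F.P K).d (fun _ => (F.P K).sitesPerDir 0)),
      ‖NegSup.equiv (levWeight (F.L : ℝ) ((F.P K).eta k) (bondLevLit F Ω k) 3) (Matrix (Fin N) (Fin N) ℂ) (DeltaPiCurOfRecord F N K k Ω U₀ Gp (QprimeOfRecord F N k U₀) A) b'‖ ≤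
        ∑ x : Bond (F.P K).d (fun _ => (F.P K).sitesPerDir 0), s0 b' x * ‖JetSup.equiv _ _ _ A x‖ +
        ∑ p : Bond (F.P K).d (fun _ => (F.P K).sitesPerDir 0) × Fin (F.P K).d, s1 b' p * ‖(nabla115 ((F.P K).eta k) (unitsOfRecord F N U₀)) (JetSup.equiv _ _ _ A) p‖)
    {Cπ σ : ℝ} (hCπ : 0 ≤ Cπ) (hσ : 0 < σ)
    (hR : ∀ (b' : Bond (F.P K).d (fun _ => (F.P K).sitesPerDir 0)) (y'' : PBond (F.P K) k),
      blockRow0 F K k s0 b' y'' + blockRow1 F K k s1 b' y'' ≤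
        Cπ * Real.exp (-(σ * (Site.tdist (blkOfBond F K k b').src y''.src : ℝ)))) :
    letI b : ℝ := (B₁ * B₂ * ((F.P K).d * (2 * (1 + 1 / (ρ / 2))) ^ (F.P K).d)) * ((F.P K).d * (2 * (1 + 1 / (ρ / 2))) ^ (F.P K).d)
    letI ΘHw : ℝ := ((((F.P K).L ^ (F.P K).d) ^ k : ℕ) : ℝ) * b
    letI N₁ : ℝ := Cπ * (B₁ * B₂ * ((F.P K).d * (2 * (1 + 1 / (ρ / 2))) ^ (F.P K).d)) * ((F.P K).d * (2 * (1 + 1 / (min σ (ρ / 2) / 2))) ^ (F.P K).d) * ((F.P K).d * (2 * (1 + 1 / (min σ (ρ / 2) / 2))) ^ (F.P K).d)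
    letI Θ' : ℝ := ((((F.P K).L ^ (F.P K).d) ^ k : ℕ) : ℝ) * N₁
    letI C₂ : ℝ := 281600000000000000 * (F.L : ℝ) * N
    letI c₄ : ℝ := 1 / (200000000000 * (F.L : ℝ) * N)
    letI r : ℝ := min (c₄ / 4) (min (1 / 2) (1 / (16 * (b * C₂ + 1))))
    letI R' : ℝ := min r ((1 - 4 * b * C₂ * (r + r)) * (1 / 16))
    letI CV : ℝ := 1024 * (((F.P K).d - 1 : ℕ) : ℝ) * ((1 : ℝ) * 1) ^ 3 * N * (α * (1 : ℝ) ^ 2 + 1 / 16)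
        + (((F.P K).d - 1 : ℕ) : ℝ) * ((1 : ℝ) * 1) ^ 3 * (136 + 2 * ((1 : ℝ) * 1)) * N
    letI G : ℝ := 2 * ((F.P K).d : ℝ) * (C₃ * (F.P K).eta k ^ (F.P K).d)
    letI θ₃ : ℝ := (2 * (1 / (1 - 4 * b * C₂ * (r + r))) + 1) * ΘHw * G / r
    letI θE : ℝ := 2 * ΘHw * G * (1 / (1 - 4 * b * C₂ * (r + r)))
    letI θE' : ℝ := 2 * Θ' * G * (1 / (1 - 4 * b * C₂ * (r + r)))
    Prop4UniformPrAtRecord F N K k Ω U₀ (hierFrameGLDatumOfRecord F N k U₀) levB a hpos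
      (QprOfRecord_surjective_hierFrameGL_of_inUkClassB11 hkm (eps_pos_of_inUkClassB11 hcl) h3 h2 hst hstδ hcl) r Gp
      ((N * θ₃ * ε₀ + (N₁ * C₂ * (1 / (1 - 4 * b * C₂ * (r + r))) ^ 2 + N * θE')
        + N * θE * (N₁ * C₂ * (1 / (1 - 4 * b * C₂ * (r + r))) ^ 2) * R'
        + N * (1 + θE * R') * CV * (1 / (1 - 4 * b * C₂ * (r + r))) ^ 2)) R' := by
  have h01 := h1pr_entryRows_of_parts F N K k Ω U₀ (hierFrameGLDatumOfRecord F N k U₀) levB a hpos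
    (QprOfRecord_surjective_hierFrameGL_of_inUkClassB11 hkm (eps_pos_of_inUkClassB11 hcl) h3 h2 hst hstδ hcl) hρ hB₁ hB₂ hG0 hG1 hKi
  exact prop4UniformPrAtRecord_node00_of_prop5Clause_hierFrameGLRec_of_entryRows_inClass F N K k Ω U₀ levB a hpos Gp hkpos hkm hΩ hαpos hα hreg h3 h2 hst hstδ
    hcl (B₀ := (B₁ * B₂ * ((F.P K).d * (2 * (1 + 1 / (ρ / 2))) ^ (F.P K).d))) (ρ := ρ / 2) (by positivity) (half_pos hρ)
    (fun y'' y => (h01 y'' y).1) (fun y'' y => (h01 y'' y).2) hC₃ h157 hrα₁ hq hs0 hs1 hS hCπ hσ hR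

end OfParts

/-! ## §2∕§3  … READ AT THE MINIMISER OF RECORD `UkSel F N K k ε V` and at its centred rooted gauge `rootGaugeC k (UkSel F N K k ε V)` -/

section AtSelector

variable (K k : ℕ) (Ω : ℕ → Set (Site (F.P K) 0))
variable [Fact (0 < (F.L : ℝ))] [Fact (0 < (F.P K).eta k)] [Fact (0 < c0Rec F K k)] [Fact (∀ c, 0 < wBRec F K k c)]

/-- ★★★ **THE OF-PARTS GL PIN AT THE MINIMISER OF RECORD** `U₀ := UkSel F N K k ε V`: §1 with the class letter in [B11] Thm 1's currency at the datum `V` (`hex : UkExists … ε V`,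
`huniq : UniqueUkOrbit … ε V`, `hcl : InUkClassB11 … ε₀ (Uk … ε V)`; 13a §0 `inUkClassB11_ukSel_of_uk`); (G), (K), `hpos`, {W3}, {W4}, window, (14) `hreg`, ceilings displayed at this `U₀`.
Glue BY NAME; nothing of [B9]∕[B11]∕[B7] proved. [cite: Balaban1985Variational, Thm 1 p.279, Prop. 4 (97)–(98) pp.292–293, (19) p.281; Balaban1985BackgroundPropagators, Thm 3.12 (3.129)–(3.133) pp.421–422; Balaban1987RG1, (0.21) p.256] -/
theorem prop4UniformPrAtRecord_node00_of_prop5Clause_hierFrameGLRec_of_h1prParts_inClass_ukSel {ε : ℝ} (V : GaugeField (F.P K) k (SU N)) (levB : PBond (F.P K) k → ℕ) (a : ℝ)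
    (hpos : ∀ x, x ≠ 0 → 0 < RCLike.re ⟪x, laplaceAOfRecord F N k (UkSel F N K k ε V) (QprOfRecord F N k (UkSel F N K k ε V) (hierFrameGLDatumOfRecord F N k (UkSel F N K k ε V))) (QprimeOfRecord F N k (UkSel F N K k ε V)) a x⟫_ℂ)
    (Gp : SiteL2K ℂ (F.P K).d (fun _ => (F.P K).sitesPerDir 0) (c0Rec F K k) (WRec N) →ₗ[ℂ]
      SiteL2K ℂ (F.P K).d (fun _ => (F.P K).sitesPerDir 0) (c0Rec F K k) (WRec N))
    {α ε₀ : ℝ} (hkpos : 0 < k) (hkm : k ≤ (F.P K).m + (F.P K).K) (hΩ : ∀ x, x ∈ Ω k) (hαpos : 0 < α) (hα : α * (11000000 * N) ≤ 1)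
    (hreg : ∀ j, j < k → PlaqSmall (α * ((F.L : ℝ) ^ j * (F.P K).eta k) ^ 2) (Averaging.iter (avOfRecord F N K) j (UkSel F N K k ε V)))
    -- {W1}'s un-framed onto row `hqon` AND the current letter `‖J(U₀)‖ ≤ nJ` BOTH from [B11] (2)'s class letter `hcl` (dag-n07-e ✓p835435 `qCplxOp_surjective_of_inUkClassB11`;
    -- ✓`norm_JOfRecordAtBg_le_of_inUkClassB11`, `nJ := ε₀`), at the price of MODULE 144's four ceilings on `ε₀` (`0 < ε₀` is forced by the class: ✓`eps_pos_of_inUkClassB11`)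
    (h3 : (143 * (((((F.P K).d + 4 : ℕ) : ℝ)) ^ 2 / 4) ^ 2) * ε₀ ≤ 1 / 3)
    (h2 : 2 * ε₀ ≤ 2 * deltaSU (Fin N) / ((((F.P K).d + 4) * (F.P K).L : ℕ) : ℝ) ^ 2)
    (hst : stokesConst (F.P K) * (2 * ε₀) < emlWeight (F.P K) / 16) (hstδ : stokesConst (F.P K) * (2 * ε₀) < deltaSU (Fin N))
    -- [B11] Thm 1's rows AT THE DATUM `V` (DISPLAYED; the consumers' currency): solvable at radius `ε`, minimal orbit unique, the minimiser `U_k(V)` in (2)'s class at `ε₀`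
    (hex : UkExists F N K k ε V) (huniq : UniqueUkOrbit F N K k ε V) (hcl : InUkClassB11 F N K k ε₀ (Uk F N K k ε V))
    -- {W2} READ FROM ITS TWO PRINTED SOURCES (print p.423 «from (3.129) and (3.132) with G₁ instead of G we get (3.133) for H₁»; dag-n06-l ✓`h1pr_entryRows_of_parts`):
    -- (G) Theorem 3.3-type entry rows of `G₁(U₀)Q^{pr,*}` read in (115), (K) the (3.132) kernel rows of `(Q^{pr}G₁Q^{pr,*})⁻¹`, both at rate `ρ` — DISPLAYED
    {ρ B₁ B₂ : ℝ} (hρ : 0 < ρ) (hB₁ : 0 ≤ B₁) (hB₂ : 0 ≤ B₂)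
    (hG0 : ∀ y'' y₁ : PBond (F.P K) k, entry0 F N K k Ω (UkSel F N K k ε V) levB (g1QadjPrRead F N K k Ω (UkSel F N K k ε V) (hierFrameGLDatumOfRecord F N k (UkSel F N K k ε V)) levB a hpos) y'' y₁ ≤ B₁ * Real.exp (-(ρ * (Site.tdist y''.src y₁.src : ℝ))))
    (hG1 : ∀ y'' y₁ : PBond (F.P K) k, entry1 F N K k Ω (UkSel F N K k ε V) levB (g1QadjPrRead F N K k Ω (UkSel F N K k ε V) (hierFrameGLDatumOfRecord F N k (UkSel F N K k ε V)) levB a hpos) y'' y₁ ≤ B₁ * Real.exp (-(ρ * (Site.tdist y''.src y₁.src : ℝ))))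
    (hKi : ∀ y₁ y : PBond (F.P K) k, ‖kerBlk F N K k levB (kinvPrRead F N K k (UkSel F N K k ε V) (hierFrameGLDatumOfRecord F N k (UkSel F N K k ε V)) levB a hpos
      (QprOfRecord_surjective_hierFrameGL_of_inUkClassB11 hkm (eps_pos_of_inUkClassB11 hcl) h3 h2 hst hstδ (inUkClassB11_ukSel_of_uk hkm hex huniq hcl))) y₁ y‖ ≤ B₂ * Real.exp (-(ρ * (Site.tdist y₁.src y.src : ℝ))))
    -- (KL-C)ᵖʳ := the (157) clause of `B7.Prop5Printed (kexpOfRecordPr F N 𝔥ᴳᴸ)` at `(α, α₁, C₃)`, `r + r ≤ α₁`, and the window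
    {C₃ α₁ : ℝ} (hC₃ : 0 ≤ C₃)
    (h157 : ∀ (i : KRecIdx F) (W₀ : (kexpOfRecordPr F N (fun K k (U : GaugeField (F.P K) 0 (SU N)) => hierFrameGLDatumOfRecord F N k U) i).Cfg), (kexpOfRecordPr F N (fun K k (U : GaugeField (F.P K) 0 (SU N)) => hierFrameGLDatumOfRecord F N k U) i).plaqDevEta W₀ < α →
      ∀ A : (kexpOfRecordPr F N (fun K k (U : GaugeField (F.P K) 0 (SU N)) => hierFrameGLDatumOfRecord F N k U) i).Fld, (kexpOfRecordPr F N (fun K k (U : GaugeField (F.P K) 0 (SU N)) => hierFrameGLDatumOfRecord F N k U) i).fldNorm A < α₁ → (kexpOfRecordPr F N (fun K k (U : GaugeField (F.P K) 0 (SU N)) => hierFrameGLDatumOfRecord F N k U) i).dCk W₀ A ≤ C₃ * (kexpOfRecordPr F N (fun K k (U : GaugeField (F.P K) 0 (SU N)) => hierFrameGLDatumOfRecord F N k U) i).fldNorm A)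
    (hrα₁ : letI b : ℝ := (B₁ * B₂ * ((F.P K).d * (2 * (1 + 1 / (ρ / 2))) ^ (F.P K).d)) * ((F.P K).d * (2 * (1 + 1 / (ρ / 2))) ^ (F.P K).d)
      letI C₂ : ℝ := 281600000000000000 * (F.L : ℝ) * N
      letI c₄ : ℝ := 1 / (200000000000 * (F.L : ℝ) * N)
      letI r : ℝ := min (c₄ / 4) (min (1 / 2) (1 / (16 * (b * C₂ + 1))))
      r + r ≤ α₁)
    -- the window, k-FREE: `(r+r)·Θ_H·G = (r+r)·b·2dC₃ · ((L^d)^k η_k^d) = (r+r)·b·2dC₃` since `L^k η_k = 1`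
    (hq : letI b : ℝ := (B₁ * B₂ * ((F.P K).d * (2 * (1 + 1 / (ρ / 2))) ^ (F.P K).d)) * ((F.P K).d * (2 * (1 + 1 / (ρ / 2))) ^ (F.P K).d)
      letI C₂ : ℝ := 281600000000000000 * (F.L : ℝ) * N
      letI c₄ : ℝ := 1 / (200000000000 * (F.L : ℝ) * N)
      letI r : ℝ := min (c₄ / 4) (min (1 / 2) (1 / (16 * (b * C₂ + 1))))
      (r + r) * b * (2 * ((F.P K).d : ℝ) * C₃) ≤ 1 / 2)
    -- {W3} := the locality rows of the current reader `Δπ(U₀; G′, Q′)` ([B11] (72)–(73)∕(86)–(89)): (L) fine majorants `s₀, s₁`, (R) block-aggregated row decay — DISPLAYED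
    {s0 : Bond (F.P K).d (fun _ => (F.P K).sitesPerDir 0) → Bond (F.P K).d (fun _ => (F.P K).sitesPerDir 0) → ℝ} {s1 : Bond (F.P K).d (fun _ => (F.P K).sitesPerDir 0) → Bond (F.P K).d (fun _ => (F.P K).sitesPerDir 0) × Fin (F.P K).d → ℝ} (hs0 : ∀ b' x, 0 ≤ s0 b' x) (hs1 : ∀ b' p, 0 ≤ s1 b' p)
    (hS : ∀ (A : Space115Lit F N K k Ω (UkSel F N K k ε V)) (b' : Bond (F.P K).d (fun _ => (F.P K).sitesPerDir 0)),
      ‖NegSup.equiv (levWeight (F.L : ℝ) ((F.P K).eta k) (bondLevLit F Ω k) 3) (Matrix (Fin N) (Fin N) ℂ) (DeltaPiCurOfRecord F N K k Ω (UkSel F N K k ε V) Gp (QprimeOfRecord F N k (UkSel F N K k ε V)) A) b'‖ ≤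
        ∑ x : Bond (F.P K).d (fun _ => (F.P K).sitesPerDir 0), s0 b' x * ‖JetSup.equiv _ _ _ A x‖ +
        ∑ p : Bond (F.P K).d (fun _ => (F.P K).sitesPerDir 0) × Fin (F.P K).d, s1 b' p * ‖(nabla115 ((F.P K).eta k) (unitsOfRecord F N (UkSel F N K k ε V))) (JetSup.equiv _ _ _ A) p‖)
    {Cπ σ : ℝ} (hCπ : 0 ≤ Cπ) (hσ : 0 < σ)
    (hR : ∀ (b' : Bond (F.P K).d (fun _ => (F.P K).sitesPerDir 0)) (y'' : PBond (F.P K) k),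
      blockRow0 F K k s0 b' y'' + blockRow1 F K k s1 b' y'' ≤
        Cπ * Real.exp (-(σ * (Site.tdist (blkOfBond F K k b').src y''.src : ℝ)))) :
    letI b : ℝ := (B₁ * B₂ * ((F.P K).d * (2 * (1 + 1 / (ρ / 2))) ^ (F.P K).d)) * ((F.P K).d * (2 * (1 + 1 / (ρ / 2))) ^ (F.P K).d)
    letI ΘHw : ℝ := ((((F.P K).L ^ (F.P K).d) ^ k : ℕ) : ℝ) * b
    letI N₁ : ℝ := Cπ * (B₁ * B₂ * ((F.P K).d * (2 * (1 + 1 / (ρ / 2))) ^ (F.P K).d)) * ((F.P K).d * (2 * (1 + 1 / (min σ (ρ / 2) / 2))) ^ (F.P K).d) * ((F.P K).d * (2 * (1 + 1 / (min σ (ρ / 2) / 2))) ^ (F.P K).d)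
    letI Θ' : ℝ := ((((F.P K).L ^ (F.P K).d) ^ k : ℕ) : ℝ) * N₁
    letI C₂ : ℝ := 281600000000000000 * (F.L : ℝ) * N
    letI c₄ : ℝ := 1 / (200000000000 * (F.L : ℝ) * N)
    letI r : ℝ := min (c₄ / 4) (min (1 / 2) (1 / (16 * (b * C₂ + 1))))
    letI R' : ℝ := min r ((1 - 4 * b * C₂ * (r + r)) * (1 / 16))
    letI CV : ℝ := 1024 * (((F.P K).d - 1 : ℕ) : ℝ) * ((1 : ℝ) * 1) ^ 3 * N * (α * (1 : ℝ) ^ 2 + 1 / 16)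
        + (((F.P K).d - 1 : ℕ) : ℝ) * ((1 : ℝ) * 1) ^ 3 * (136 + 2 * ((1 : ℝ) * 1)) * N
    letI G : ℝ := 2 * ((F.P K).d : ℝ) * (C₃ * (F.P K).eta k ^ (F.P K).d)
    letI θ₃ : ℝ := (2 * (1 / (1 - 4 * b * C₂ * (r + r))) + 1) * ΘHw * G / r
    letI θE : ℝ := 2 * ΘHw * G * (1 / (1 - 4 * b * C₂ * (r + r)))
    letI θE' : ℝ := 2 * Θ' * G * (1 / (1 - 4 * b * C₂ * (r + r)))
    Prop4UniformPrAtRecord F N K k Ω (UkSel F N K k ε V) (hierFrameGLDatumOfRecord F N k (UkSel F N K k ε V)) levB a hpos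
      (QprOfRecord_surjective_hierFrameGL_of_inUkClassB11 hkm (eps_pos_of_inUkClassB11 hcl) h3 h2 hst hstδ (inUkClassB11_ukSel_of_uk hkm hex huniq hcl)) r Gp
      ((N * θ₃ * ε₀ + (N₁ * C₂ * (1 / (1 - 4 * b * C₂ * (r + r))) ^ 2 + N * θE')
        + N * θE * (N₁ * C₂ * (1 / (1 - 4 * b * C₂ * (r + r))) ^ 2) * R'
        + N * (1 + θE * R') * CV * (1 / (1 - 4 * b * C₂ * (r + r))) ^ 2)) R' := by
  have h01 := h1pr_entryRows_of_parts F N K k Ω (UkSel F N K k ε V) (hierFrameGLDatumOfRecord F N k (UkSel F N K k ε V)) levB a hpos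
    (QprOfRecord_surjective_hierFrameGL_of_inUkClassB11 hkm (eps_pos_of_inUkClassB11 hcl) h3 h2 hst hstδ (inUkClassB11_ukSel_of_uk hkm hex huniq hcl)) hρ hB₁ hB₂ hG0 hG1 hKi
  exact prop4UniformPrAtRecord_node00_of_prop5Clause_hierFrameGLRec_of_entryRows_inClass_ukSel F N K k Ω V levB a hpos Gp hkpos hkm hΩ hαpos hα hreg h3 h2 hst hstδ
    hex huniq hcl (B₀ := (B₁ * B₂ * ((F.P K).d * (2 * (1 + 1 / (ρ / 2))) ^ (F.P K).d))) (ρ := ρ / 2) (by positivity) (half_pos hρ)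
    (fun y'' y => (h01 y'' y).1) (fun y'' y => (h01 y'' y).2) hC₃ h157 hrα₁ hq hs0 hs1 hS hCπ hσ hR

/-- ★★★ **THE OF-PARTS GL PIN AT THE CENTRED ROOTED GAUGE OF THE MINIMISER OF RECORD** `U₀ := rootGaugeC k (UkSel F N K k ε V)` (DEF-1's `recordBgFieldC` shape): §1 with the class
letter from [B11] Thm 1's rows at `V` (13a §0 `inUkClassB11_rootGaugeC_ukSel_of_uk`); (G), (K), `hpos`, {W3}, {W4}, window, (14) `hreg`, ceilings displayed at this `U₀`.  Glue BY NAME;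
nothing of [B9]∕[B11]∕[B7] proved. [cite: Balaban1985Variational, Thm 1 p.279, Prop. 4 (97)–(98) pp.292–293, (19) p.281; Balaban1985BackgroundPropagators, Thm 3.12 (3.129)–(3.133) pp.421–422; Balaban1987RG1, (0.21) p.256] -/
theorem prop4UniformPrAtRecord_node00_of_prop5Clause_hierFrameGLRec_of_h1prParts_inClass_rootGaugeC_ukSel {ε : ℝ} (V : GaugeField (F.P K) k (SU N)) (levB : PBond (F.P K) k → ℕ) (a : ℝ)
    (hpos : ∀ x, x ≠ 0 → 0 < RCLike.re ⟪x, laplaceAOfRecord F N k (rootGaugeC k (UkSel F N K k ε V)) (QprOfRecord F N k (rootGaugeC k (UkSel F N K k ε V)) (hierFrameGLDatumOfRecord F N k (rootGaugeC k (UkSel F N K k ε V)))) (QprimeOfRecord F N k (rootGaugeC k (UkSel F N K k ε V))) a x⟫_ℂ)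
    (Gp : SiteL2K ℂ (F.P K).d (fun _ => (F.P K).sitesPerDir 0) (c0Rec F K k) (WRec N) →ₗ[ℂ]
      SiteL2K ℂ (F.P K).d (fun _ => (F.P K).sitesPerDir 0) (c0Rec F K k) (WRec N))
    {α ε₀ : ℝ} (hkpos : 0 < k) (hkm : k ≤ (F.P K).m + (F.P K).K) (hΩ : ∀ x, x ∈ Ω k) (hαpos : 0 < α) (hα : α * (11000000 * N) ≤ 1)
    (hreg : ∀ j, j < k → PlaqSmall (α * ((F.L : ℝ) ^ j * (F.P K).eta k) ^ 2) (Averaging.iter (avOfRecord F N K) j (rootGaugeC k (UkSel F N K k ε V))))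
    -- {W1}'s un-framed onto row `hqon` AND the current letter `‖J(U₀)‖ ≤ nJ` BOTH from [B11] (2)'s class letter `hcl` (dag-n07-e ✓p835435 `qCplxOp_surjective_of_inUkClassB11`;
    -- ✓`norm_JOfRecordAtBg_le_of_inUkClassB11`, `nJ := ε₀`), at the price of MODULE 144's four ceilings on `ε₀` (`0 < ε₀` is forced by the class: ✓`eps_pos_of_inUkClassB11`)
    (h3 : (143 * (((((F.P K).d + 4 : ℕ) : ℝ)) ^ 2 / 4) ^ 2) * ε₀ ≤ 1 / 3)
    (h2 : 2 * ε₀ ≤ 2 * deltaSU (Fin N) / ((((F.P K).d + 4) * (F.P K).L : ℕ) : ℝ) ^ 2)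
    (hst : stokesConst (F.P K) * (2 * ε₀) < emlWeight (F.P K) / 16) (hstδ : stokesConst (F.P K) * (2 * ε₀) < deltaSU (Fin N))
    -- [B11] Thm 1's rows AT THE DATUM `V` (DISPLAYED; the consumers' currency): solvable at radius `ε`, minimal orbit unique, the minimiser `U_k(V)` in (2)'s class at `ε₀`
    (hex : UkExists F N K k ε V) (huniq : UniqueUkOrbit F N K k ε V) (hcl : InUkClassB11 F N K k ε₀ (Uk F N K k ε V))
    -- {W2} READ FROM ITS TWO PRINTED SOURCES (print p.423 «from (3.129) and (3.132) with G₁ instead of G we get (3.133) for H₁»; dag-n06-l ✓`h1pr_entryRows_of_parts`):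
    -- (G) Theorem 3.3-type entry rows of `G₁(U₀)Q^{pr,*}` read in (115), (K) the (3.132) kernel rows of `(Q^{pr}G₁Q^{pr,*})⁻¹`, both at rate `ρ` — DISPLAYED
    {ρ B₁ B₂ : ℝ} (hρ : 0 < ρ) (hB₁ : 0 ≤ B₁) (hB₂ : 0 ≤ B₂)
    (hG0 : ∀ y'' y₁ : PBond (F.P K) k, entry0 F N K k Ω (rootGaugeC k (UkSel F N K k ε V)) levB (g1QadjPrRead F N K k Ω (rootGaugeC k (UkSel F N K k ε V)) (hierFrameGLDatumOfRecord F N k (rootGaugeC k (UkSel F N K k ε V))) levB a hpos) y'' y₁ ≤ B₁ * Real.exp (-(ρ * (Site.tdist y''.src y₁.src : ℝ))))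
    (hG1 : ∀ y'' y₁ : PBond (F.P K) k, entry1 F N K k Ω (rootGaugeC k (UkSel F N K k ε V)) levB (g1QadjPrRead F N K k Ω (rootGaugeC k (UkSel F N K k ε V)) (hierFrameGLDatumOfRecord F N k (rootGaugeC k (UkSel F N K k ε V))) levB a hpos) y'' y₁ ≤ B₁ * Real.exp (-(ρ * (Site.tdist y''.src y₁.src : ℝ))))
    (hKi : ∀ y₁ y : PBond (F.P K) k, ‖kerBlk F N K k levB (kinvPrRead F N K k (rootGaugeC k (UkSel F N K k ε V)) (hierFrameGLDatumOfRecord F N k (rootGaugeC k (UkSel F N K k ε V))) levB a hpos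
      (QprOfRecord_surjective_hierFrameGL_of_inUkClassB11 hkm (eps_pos_of_inUkClassB11 hcl) h3 h2 hst hstδ (inUkClassB11_rootGaugeC_ukSel_of_uk hkm hex huniq hcl))) y₁ y‖ ≤ B₂ * Real.exp (-(ρ * (Site.tdist y₁.src y.src : ℝ))))
    -- (KL-C)ᵖʳ := the (157) clause of `B7.Prop5Printed (kexpOfRecordPr F N 𝔥ᴳᴸ)` at `(α, α₁, C₃)`, `r + r ≤ α₁`, and the window
    {C₃ α₁ : ℝ} (hC₃ : 0 ≤ C₃)
    (h157 : ∀ (i : KRecIdx F) (W₀ : (kexpOfRecordPr F N (fun K k (U : GaugeField (F.P K) 0 (SU N)) => hierFrameGLDatumOfRecord F N k U) i).Cfg), (kexpOfRecordPr F N (fun K k (U : GaugeField (F.P K) 0 (SU N)) => hierFrameGLDatumOfRecord F N k U) i).plaqDevEta W₀ < α →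
      ∀ A : (kexpOfRecordPr F N (fun K k (U : GaugeField (F.P K) 0 (SU N)) => hierFrameGLDatumOfRecord F N k U) i).Fld, (kexpOfRecordPr F N (fun K k (U : GaugeField (F.P K) 0 (SU N)) => hierFrameGLDatumOfRecord F N k U) i).fldNorm A < α₁ → (kexpOfRecordPr F N (fun K k (U : GaugeField (F.P K) 0 (SU N)) => hierFrameGLDatumOfRecord F N k U) i).dCk W₀ A ≤ C₃ * (kexpOfRecordPr F N (fun K k (U : GaugeField (F.P K) 0 (SU N)) => hierFrameGLDatumOfRecord F N k U) i).fldNorm A)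
    (hrα₁ : letI b : ℝ := (B₁ * B₂ * ((F.P K).d * (2 * (1 + 1 / (ρ / 2))) ^ (F.P K).d)) * ((F.P K).d * (2 * (1 + 1 / (ρ / 2))) ^ (F.P K).d)
      letI C₂ : ℝ := 281600000000000000 * (F.L : ℝ) * N
      letI c₄ : ℝ := 1 / (200000000000 * (F.L : ℝ) * N)
      letI r : ℝ := min (c₄ / 4) (min (1 / 2) (1 / (16 * (b * C₂ + 1))))
      r + r ≤ α₁)
    -- the window, k-FREE: `(r+r)·Θ_H·G = (r+r)·b·2dC₃ · ((L^d)^k η_k^d) = (r+r)·b·2dC₃` since `L^k η_k = 1`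
    (hq : letI b : ℝ := (B₁ * B₂ * ((F.P K).d * (2 * (1 + 1 / (ρ / 2))) ^ (F.P K).d)) * ((F.P K).d * (2 * (1 + 1 / (ρ / 2))) ^ (F.P K).d)
      letI C₂ : ℝ := 281600000000000000 * (F.L : ℝ) * N
      letI c₄ : ℝ := 1 / (200000000000 * (F.L : ℝ) * N)
      letI r : ℝ := min (c₄ / 4) (min (1 / 2) (1 / (16 * (b * C₂ + 1))))
      (r + r) * b * (2 * ((F.P K).d : ℝ) * C₃) ≤ 1 / 2)
    -- {W3} := the locality rows of the current reader `Δπ(U₀; G′, Q′)` ([B11] (72)–(73)∕(86)–(89)): (L) fine majorants `s₀, s₁`, (R) block-aggregated row decay — DISPLAYED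
    {s0 : Bond (F.P K).d (fun _ => (F.P K).sitesPerDir 0) → Bond (F.P K).d (fun _ => (F.P K).sitesPerDir 0) → ℝ} {s1 : Bond (F.P K).d (fun _ => (F.P K).sitesPerDir 0) → Bond (F.P K).d (fun _ => (F.P K).sitesPerDir 0) × Fin (F.P K).d → ℝ} (hs0 : ∀ b' x, 0 ≤ s0 b' x) (hs1 : ∀ b' p, 0 ≤ s1 b' p)
    (hS : ∀ (A : Space115Lit F N K k Ω (rootGaugeC k (UkSel F N K k ε V))) (b' : Bond (F.P K).d (fun _ => (F.P K).sitesPerDir 0)),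
      ‖NegSup.equiv (levWeight (F.L : ℝ) ((F.P K).eta k) (bondLevLit F Ω k) 3) (Matrix (Fin N) (Fin N) ℂ) (DeltaPiCurOfRecord F N K k Ω (rootGaugeC k (UkSel F N K k ε V)) Gp (QprimeOfRecord F N k (rootGaugeC k (UkSel F N K k ε V))) A) b'‖ ≤
        ∑ x : Bond (F.P K).d (fun _ => (F.P K).sitesPerDir 0), s0 b' x * ‖JetSup.equiv _ _ _ A x‖ +
        ∑ p : Bond (F.P K).d (fun _ => (F.P K).sitesPerDir 0) × Fin (F.P K).d, s1 b' p * ‖(nabla115 ((F.P K).eta k) (unitsOfRecord F N (rootGaugeC k (UkSel F N K k ε V)))) (JetSup.equiv _ _ _ A) p‖)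
    {Cπ σ : ℝ} (hCπ : 0 ≤ Cπ) (hσ : 0 < σ)
    (hR : ∀ (b' : Bond (F.P K).d (fun _ => (F.P K).sitesPerDir 0)) (y'' : PBond (F.P K) k),
      blockRow0 F K k s0 b' y'' + blockRow1 F K k s1 b' y'' ≤
        Cπ * Real.exp (-(σ * (Site.tdist (blkOfBond F K k b').src y''.src : ℝ)))) :
    letI b : ℝ := (B₁ * B₂ * ((F.P K).d * (2 * (1 + 1 / (ρ / 2))) ^ (F.P K).d)) * ((F.P K).d * (2 * (1 + 1 / (ρ / 2))) ^ (F.P K).d)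
    letI ΘHw : ℝ := ((((F.P K).L ^ (F.P K).d) ^ k : ℕ) : ℝ) * b
    letI N₁ : ℝ := Cπ * (B₁ * B₂ * ((F.P K).d * (2 * (1 + 1 / (ρ / 2))) ^ (F.P K).d)) * ((F.P K).d * (2 * (1 + 1 / (min σ (ρ / 2) / 2))) ^ (F.P K).d) * ((F.P K).d * (2 * (1 + 1 / (min σ (ρ / 2) / 2))) ^ (F.P K).d)
    letI Θ' : ℝ := ((((F.P K).L ^ (F.P K).d) ^ k : ℕ) : ℝ) * N₁
    letI C₂ : ℝ := 281600000000000000 * (F.L : ℝ) * N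
    letI c₄ : ℝ := 1 / (200000000000 * (F.L : ℝ) * N)
    letI r : ℝ := min (c₄ / 4) (min (1 / 2) (1 / (16 * (b * C₂ + 1))))
    letI R' : ℝ := min r ((1 - 4 * b * C₂ * (r + r)) * (1 / 16))
    letI CV : ℝ := 1024 * (((F.P K).d - 1 : ℕ) : ℝ) * ((1 : ℝ) * 1) ^ 3 * N * (α * (1 : ℝ) ^ 2 + 1 / 16)
        + (((F.P K).d - 1 : ℕ) : ℝ) * ((1 : ℝ) * 1) ^ 3 * (136 + 2 * ((1 : ℝ) * 1)) * N
    letI G : ℝ := 2 * ((F.P K).d : ℝ) * (C₃ * (F.P K).eta k ^ (F.P K).d)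
    letI θ₃ : ℝ := (2 * (1 / (1 - 4 * b * C₂ * (r + r))) + 1) * ΘHw * G / r
    letI θE : ℝ := 2 * ΘHw * G * (1 / (1 - 4 * b * C₂ * (r + r)))
    letI θE' : ℝ := 2 * Θ' * G * (1 / (1 - 4 * b * C₂ * (r + r)))
    Prop4UniformPrAtRecord F N K k Ω (rootGaugeC k (UkSel F N K k ε V)) (hierFrameGLDatumOfRecord F N k (rootGaugeC k (UkSel F N K k ε V))) levB a hpos
      (QprOfRecord_surjective_hierFrameGL_of_inUkClassB11 hkm (eps_pos_of_inUkClassB11 hcl) h3 h2 hst hstδ (inUkClassB11_rootGaugeC_ukSel_of_uk hkm hex huniq hcl)) r Gp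
      ((N * θ₃ * ε₀ + (N₁ * C₂ * (1 / (1 - 4 * b * C₂ * (r + r))) ^ 2 + N * θE')
        + N * θE * (N₁ * C₂ * (1 / (1 - 4 * b * C₂ * (r + r))) ^ 2) * R'
        + N * (1 + θE * R') * CV * (1 / (1 - 4 * b * C₂ * (r + r))) ^ 2)) R' := by
  have h01 := h1pr_entryRows_of_parts F N K k Ω (rootGaugeC k (UkSel F N K k ε V)) (hierFrameGLDatumOfRecord F N k (rootGaugeC k (UkSel F N K k ε V))) levB a hpos
    (QprOfRecord_surjective_hierFrameGL_of_inUkClassB11 hkm (eps_pos_of_inUkClassB11 hcl) h3 h2 hst hstδ (inUkClassB11_rootGaugeC_ukSel_of_uk hkm hex huniq hcl)) hρ hB₁ hB₂ hG0 hG1 hKi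
  exact prop4UniformPrAtRecord_node00_of_prop5Clause_hierFrameGLRec_of_entryRows_inClass_rootGaugeC_ukSel F N K k Ω V levB a hpos Gp hkpos hkm hΩ hαpos hα hreg h3 h2 hst hstδ
    hex huniq hcl (B₀ := (B₁ * B₂ * ((F.P K).d * (2 * (1 + 1 / (ρ / 2))) ^ (F.P K).d))) (ρ := ρ / 2) (by positivity) (half_pos hρ)
    (fun y'' y => (h01 y'' y).1) (fun y'' y => (h01 y'' y).2) hC₃ h157 hrα₁ hq hs0 hs1 hS hCπ hσ hR

end AtSelector

end Summit.QuantumFields.YangMills.Theorems.KExpOfRecordPr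

end
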